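import Literature.AlgebraicTopology.SingularHomology.LocalDegreeSign
import Literature.AlgebraicTopology.SingularHomology.LocalClassFamilies
import Mathlib.Topology.Compactification.OnePoint.Basic
import HarnessLib

/-!
# The collapse map onto the one-point compactification of an open subset

L. S. Pontryagin / R. Thom's collapse (J. Milnor, *Topology from the Differentiable Viewpoint*
(1965), §7, "the Pontryagin construction"; tom Dieck, *Algebraic Topology* (2008), §1.4 on
one-point compactifications): for an open subset `G` of a Hausdorff space `X` identified with a
space `Y` by a homeomorphism `φ : G ≃ Y`, the map `X → Y⁺ = OnePoint Y` which is `φ` on `G` and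
sends `X ∖ G` to the point at infinity is continuous. Off infinity it is the open embedding
`G ↪ Y⁺`, so it induces isomorphisms of local homology groups at the points of `G`, and each
finite point of `Y⁺` has exactly one preimage.

* `OnePoint.collapse G φ`, `continuous_collapse`, `collapse_apply_of_mem`, `collapse_apply_of_not_mem`;
* `OnePoint.mapsTo_collapse_compl_singleton` — uniqueness of preimages of finite points;
* `OnePoint.isIso_map_collapse_local` — `Hₖ(X | x) ≅ Hₖ(Y⁺ | φ x)` along the collapse.

This is the map `Ŵ₁ ♮ Ŵ₂ → Ŵᵢ` ("collapse the other summand") used for the additivity of the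
signature over boundary connected sums (Kervaire–Milnor 1963, §2). Everything is proved; no
named facts.

## References

* J. Milnor, *Topology from the Differentiable Viewpoint*, UP Virginia 1965, §7. [MilnorTDV1965]
* A. Hatcher, *Algebraic Topology*, CUP 2002, §3.3 p. 231 (locality of `Hₖ(X | x)`). [HatcherAT2002]
-/

noncomputable section

open CategoryTheory Set Function Topology Filter
open Literature.AlgebraicTopology.SingularHomology

universe u

namespace Literature.AlgebraicTopology.SingularHomology

/-! The declarations live in the path namespace with a grouping sub-namespace `OnePoint`
(they are about `OnePoint Y` but take no argument of that type, so they are not dot-notation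
extensions of Mathlib's `OnePoint`). -/

namespace OnePoint

open _root_.OnePoint

variable {X Y : Type u} [TopologicalSpace X] [TopologicalSpace Y]

open Classical in
/-- **The collapse map** `X → Y⁺`: `φ` on the open set `G`, the point at infinity elsewhere
(Milnor 1965, §7, Pontryagin construction). [cite: MilnorTDV1965, §7] -/
def collapse (G : Set X) (φ : ↥G → Y) : X → OnePoint Y :=
  fun x => if h : x ∈ G then ((φ ⟨x, h⟩ : Y) : OnePoint Y) else ∞

omit [TopologicalSpace X] [TopologicalSpace Y] in
/-- Value of the collapse on `G`. [folklore] -/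
theorem collapse_apply_of_mem (G : Set X) (φ : ↥G → Y) {x : X} (hx : x ∈ G) :
    collapse G φ x = ((φ ⟨x, hx⟩ : Y) : OnePoint Y) := by
  unfold collapse; rw [dif_pos hx]

omit [TopologicalSpace X] [TopologicalSpace Y] in
/-- Value of the collapse on a point of `G`. [folklore] -/
@[simp] theorem collapse_apply_coe (G : Set X) (φ : ↥G → Y) (x : ↥G) :
    collapse G φ x = ((φ x : Y) : OnePoint Y) := by
  rw [collapse_apply_of_mem G φ x.2]

omit [TopologicalSpace X] [TopologicalSpace Y] in
/-- Value of the collapse off `G`. [folklore] -/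
theorem collapse_apply_of_not_mem (G : Set X) (φ : ↥G → Y) {x : X} (hx : x ∉ G) :
    collapse G φ x = ∞ := by
  unfold collapse; rw [dif_neg hx]

omit [TopologicalSpace X] [TopologicalSpace Y] in
open Classical in
/-- Preimages of sets under the collapse. [folklore] -/
theorem preimage_collapse (G : Set X) (φ : ↥G → Y) (s : Set (OnePoint Y)) :
    collapse G φ ⁻¹' s =
      Subtype.val '' (φ ⁻¹' ((↑) ⁻¹' s)) ∪ (if ∞ ∈ s then Gᶜ else ∅) := by
  ext x
  by_cases hx : x ∈ G
  · rw [mem_preimage, collapse_apply_of_mem G φ hx]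
    constructor
    · intro h
      exact Or.inl ⟨⟨x, hx⟩, h, rfl⟩
    · rintro (⟨y, hy, rfl⟩ | h)
      · exact hy
      · split_ifs at h with h'
        · exact absurd hx h
        · exact absurd h (notMem_empty _)
  · rw [mem_preimage, collapse_apply_of_not_mem G φ hx]
    constructor
    · intro h
      refine Or.inr ?_
      rw [if_pos h]
      exact hx
    · rintro (⟨y, _, rfl⟩ | h)
      · exact absurd y.2 hx
      · split_ifs at h with h'
        · exact h'
        · exact absurd h (notMem_empty _)

/-- **The collapse map is continuous** for `G` open, `φ : G ≃ₜ Y` a homeomorphism and `X`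
Hausdorff: the preimage of an open `V ⊆ Y` is the open set `φ⁻¹ V ⊆ G ⊆ X`, and the preimage of
a neighbourhood `Y⁺ ∖ K` of `∞` (`K` compact) is the complement of the compact set `φ⁻¹ K`
(Milnor 1965, §7). [cite: MilnorTDV1965, §7] -/
theorem continuous_collapse [T2Space X] {G : Set X} (hG : IsOpen G) (φ : ↥G ≃ₜ Y) :
    Continuous (collapse G φ) := by
  classical
  rw [continuous_def]
  intro s hs
  rw [OnePoint.isOpen_def] at hs
  rw [preimage_collapse]
  have h1 : IsOpen (Subtype.val '' ((φ : ↥G → Y) ⁻¹' ((↑) ⁻¹' s)) : Set X) :=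
    hG.isOpenMap_subtype_val _ (hs.2.preimage φ.continuous)
  by_cases h : ∞ ∈ s
  · rw [if_pos h]
    -- the complement of the preimage is the compact `φ⁻¹ K`
    have hK : IsCompact (((↑) ⁻¹' s : Set Y)ᶜ) := hs.1 h
    have hc : (Subtype.val '' ((φ : ↥G → Y) ⁻¹' ((↑) ⁻¹' s)) ∪ Gᶜ : Set X) =
        (Subtype.val '' ((φ : ↥G → Y) ⁻¹' (((↑) ⁻¹' s : Set Y)ᶜ)))ᶜ := by
      ext x
      by_cases hx : x ∈ G
      · constructor
        · rintro (⟨y, hy, rfl⟩ | h') ⟨y', hy', hyy'⟩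
          · cases Subtype.val_injective hyy'
            exact hy' hy
          · exact h' hx
        · intro h'
          refine Or.inl ⟨⟨x, hx⟩, ?_, rfl⟩
          by_contra hns
          exact h' ⟨⟨x, hx⟩, hns, rfl⟩
      · constructor
        · rintro _ ⟨y, _, rfl⟩
          exact hx y.2
        · intro _
          exact Or.inr hx
    rw [hc, isOpen_compl_iff]
    exact ((φ.isCompact_preimage.2 hK).image continuous_subtype_val).isClosed
  · rw [if_neg h, union_empty]
    exact h1

/-- The collapse map as a continuous map. [folklore] -/
def collapseCM [T2Space X] {G : Set X} (hG : IsOpen G) (φ : ↥G ≃ₜ Y) : C(X, OnePoint Y) :=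
  ⟨collapse G φ, continuous_collapse hG φ⟩

/-- Values of `collapseCM`. [folklore] -/
@[simp] theorem collapseCM_apply [T2Space X] {G : Set X} (hG : IsOpen G) (φ : ↥G ≃ₜ Y) (x : X) :
    collapseCM hG φ x = collapse G φ x := rfl

omit [TopologicalSpace X] [TopologicalSpace Y] in
/-- **Finite points have a unique preimage**: the collapse is a map of pairs
`(X, X ∖ x₀) → (Y⁺, Y⁺ ∖ φ x₀)` for `x₀ ∈ G` (`φ` injective). [folklore] -/
theorem mapsTo_collapse_compl_singleton {G : Set X} {φ : ↥G → Y} (hφ : Injective φ) (x₀ : ↥G) :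
    MapsTo (collapse G φ) ({(x₀ : X)}ᶜ : Set X) ({((φ x₀ : Y) : OnePoint Y)}ᶜ : Set (OnePoint Y)) := by
  intro x hx h
  rw [mem_singleton_iff] at h
  by_cases hxG : x ∈ G
  · rw [collapse_apply_of_mem G φ hxG, OnePoint.coe_eq_coe] at h
    exact hx (congrArg Subtype.val (hφ h))
  · rw [collapse_apply_of_not_mem G φ hxG] at h
    exact OnePoint.infty_ne_coe _ h

omit [TopologicalSpace X] [TopologicalSpace Y] in
/-- Off `G` the collapse avoids every finite point (`X ∖ G ↦ ∞`). [folklore] -/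
theorem collapse_mem_compl_of_not_mem {G : Set X} (φ : ↥G → Y) {x : X} (hx : x ∉ G) (y : Y) :
    collapse G φ x ∈ ({(y : OnePoint Y)}ᶜ : Set (OnePoint Y)) := by
  rw [mem_compl_iff, mem_singleton_iff, collapse_apply_of_not_mem G φ hx]
  exact OnePoint.infty_ne_coe y

variable (R : Type u) [CommRing R] (M : Type u) [AddCommGroup M] [Module R M]

/-- **The collapse induces isomorphisms of local homology at the points of `G`**:
`Hₖ(X | x₀) ≅ Hₖ(Y⁺ | φ x₀)` — on `G` the collapse is the open embedding `G ≅ Y ↪ Y⁺`, and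
`Hₖ(G | x₀) ≅ Hₖ(X | x₀)` by excision (Hatcher 2002, §3.3 p. 231). [cite: HatcherAT2002, §3.3 p. 231] -/
theorem isIso_map_collapse_local [T2Space X] [T1Space Y] {G : Set X} (hG : IsOpen G) (φ : ↥G ≃ₜ Y)
    (x₀ : ↥G) (k : ℕ) :
    IsIso (relativeSingularHomology.map R M (collapseCM hG φ)
      (mapsTo_collapse_compl_singleton φ.injective x₀) k) := by
  -- factor `collapse ∘ val = coe ∘ φ` on `G`
  have hoe : IsOpenEmbedding (fun x : ↥G => ((φ x : Y) : OnePoint Y)) :=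
    OnePoint.isOpenEmbedding_coe.comp φ.isOpenEmbedding
  let cφ : C(↥G, OnePoint Y) := ⟨fun x => ((φ x : Y) : OnePoint Y), hoe.continuous⟩
  have hcomp : (collapseCM hG φ).comp (subsetIncl G) = cφ := by
    ext x : 1
    exact collapse_apply_coe G φ x
  have hval : MapsTo (subsetIncl G) ({x₀}ᶜ : Set ↥G) ({(x₀ : X)}ᶜ : Set X) :=
    LocalFamily.mapsTo_compl_pt Subtype.val_injective x₀
  haveI i1 : IsIso (relativeSingularHomology.map R M (subsetIncl G) hval k) :=
    localHomology.isIso_map_subsetIncl_of_isOpen R M hG x₀.2 k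
  haveI i2 : IsIso (relativeSingularHomology.map R M cφ (LocalFamily.mapsTo_compl_pt hoe.injective x₀) k) :=
    localHomology.isIso_map_of_isOpenEmbedding_of_eq R M cφ hoe x₀ rfl k
  have hfac : relativeSingularHomology.map R M (subsetIncl G) hval k ≫
      relativeSingularHomology.map R M (collapseCM hG φ)
        (mapsTo_collapse_compl_singleton φ.injective x₀) k =
      relativeSingularHomology.map R M cφ (LocalFamily.mapsTo_compl_pt hoe.injective x₀) k := by
    rw [← relativeSingularHomology.map_comp]
    exact relativeSingularHomology.map.congr_simp R M _ _ hcomp _ k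
  have : relativeSingularHomology.map R M (collapseCM hG φ)
      (mapsTo_collapse_compl_singleton φ.injective x₀) k =
      inv (relativeSingularHomology.map R M (subsetIncl G) hval k) ≫
        relativeSingularHomology.map R M cφ (LocalFamily.mapsTo_compl_pt hoe.injective x₀) k := by
    rw [← hfac, IsIso.inv_hom_id_assoc]
  rw [this]
  infer_instance

end OnePoint

end Literature.AlgebraicTopology.SingularHomology
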